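import Mathlib
import Summits.KontsevichZagierPeriods.Zeta5Search.ClassExpRigidityProof
import HarnessLib

/-!
# ζ(5) search — the floor inequality (T1-iii) for `W`, part 1: top partners, pair sums, and Step 1 (single-pole classes)

Cell `pub-zeta5` (HONEST FRAMING: systematic search; no irrationality claim unless certified), typer seat
generation 9.  Preliminaries for the Lean proof of gen-2 g7's floor inequality `FloorInequalityW`
(`Zeta5Search/ClusterValuation.lean` §2; REPORT-gen2-g7 §1), completed in `FloorInequalityWProof.lean`:

* `topPartners_eq_card`: `a_p(b) = #{k ≠ j₁ : N_{j₁k} ≥ 1}` for a least parameter `b_{j₁}`, and the charging bound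
  `topPartners_add_le_star`: `a_p + Σ_{k ∈ T} (N_{j₁k} − 1) ≤ Σ_{k ≠ j₁} N_{j₁k}` for any set `T` of partners;
* `pairSum_mono`, `one_le_pairSum`: monotonicity of the restricted pair-floor sums and a unit from one pair;
* **Step 1** (`lawW_nonpos_of_not_goodClasses`): if `H(3)` fails then `law_W ≤ 0` — `law_W = 1` would force `a_p = N_p`, hence
  `N_{ik} = 0` off the star of `j₁`, and then (F1)/(F2) confine every multipole class to two points of `B_{j₁} ∩ B_{j₂}`, so `H(3)`.
Integer bookkeeping (`p ≥ 1`, the polytope); nothing about irrationality.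
-/

noncomputable section

open Finset

namespace Summit.KontsevichZagierPeriods.Zeta5Search.ClusterValuation

open Summit.KontsevichZagierPeriods.Zeta5Search.DualSeries (InBox)
open Summit.KontsevichZagierPeriods.Zeta5Search.CasoratianValuation (InPolytope pairFloors refundW bMin topPartners)

/-! ### Top partners through a least parameter -/

/-- A least parameter realises `bMin`. -/
theorem bMin_eq_of_min (b : ℕ → ℤ) {j₁ : ℕ} (hj₁ : j₁ ∈ range 7) (hmin₁ : ∀ k ∈ range 7, b (j₁ + 1) ≤ b (k + 1)) :
    bMin b = b (j₁ + 1) := by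
  unfold bMin
  refine le_antisymm (min'_le _ _ (mem_image.2 ⟨j₁, hj₁, rfl⟩)) (le_min' _ _ _ fun y hy => ?_)
  obtain ⟨k, hk, rfl⟩ := mem_image.1 hy
  exact hmin₁ k hk

/-- **`a_p(b) = #{k ≠ j₁ : ⌊(b₀ − b_{j₁} − b_k)/p⌋ ≥ 1}`** for a least parameter `b_{j₁}`. -/
theorem topPartners_eq_card (b : ℕ → ℤ) {p : ℕ} (hp : 0 < p) {j₁ : ℕ} (hj₁ : j₁ ∈ range 7)
    (hmin₁ : ∀ k ∈ range 7, b (j₁ + 1) ≤ b (k + 1)) :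
    topPartners b p = ((((range 7).erase j₁).filter fun k => 1 ≤ pairTerm b p j₁ k).card : ℤ) := by
  have he := bMin_eq_of_min b hj₁ hmin₁
  have hiff : ∀ k, (p : ℤ) ≤ b 0 - b (k + 1) - bMin b ↔ 1 ≤ pairTerm b p j₁ k := by
    intro k
    unfold pairTerm
    rw [he, Int.le_ediv_iff_mul_le (by exact_mod_cast hp), one_mul]
    constructor <;> intro h <;> linarith
  set S := (range 7).filter fun i => (p : ℤ) ≤ b 0 - b (i + 1) - bMin b with hS
  have hS' : ((range 7).erase j₁).filter (fun k => 1 ≤ pairTerm b p j₁ k) = S.erase j₁ := by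
    ext k
    simp only [hS, mem_filter, mem_erase, hiff]
    tauto
  rw [hS']
  unfold topPartners
  rw [← hS]
  by_cases hc : (p : ℤ) ≤ b 0 - 2 * bMin b
  · have hmem : j₁ ∈ S := by
      rw [hS, mem_filter]; exact ⟨hj₁, by rw [he]; linarith⟩
    rw [if_pos hc, card_erase_of_mem hmem]
    have := card_pos.2 ⟨j₁, hmem⟩
    omega
  · have hnmem : j₁ ∉ S := by
      rw [hS, mem_filter]; intro h; apply hc; rw [he] at h; linarith [h.2]
    rw [if_neg hc, erase_eq_of_notMem hnmem]; ring

/-- **Charging the top partners**: for any set `T` of partners of `j₁` (indices `k ≠ j₁` with `N_{j₁k} ≥ 1`),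
`a_p + Σ_{k ∈ T} (N_{j₁k} − 1) ≤ Σ_{k ≠ j₁} N_{j₁k}`. -/
theorem topPartners_add_le_star (b : ℕ → ℤ) (hb : InPolytope b) {p : ℕ} (hp : 0 < p) {j₁ : ℕ} (hj₁ : j₁ ∈ range 7)
    (hmin₁ : ∀ k ∈ range 7, b (j₁ + 1) ≤ b (k + 1)) {T : Finset ℕ} (hT : T ⊆ (range 7).erase j₁)
    (hT1 : ∀ k ∈ T, 1 ≤ pairTerm b p j₁ k) :
    topPartners b p + ∑ k ∈ T, (pairTerm b p j₁ k - 1) ≤ ∑ k ∈ (range 7).erase j₁, pairTerm b p j₁ k := by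
  have hj₁7 := mem_range.1 hj₁
  rw [topPartners_eq_card b hp hj₁ hmin₁]
  set R₁ := (range 7).erase j₁ with hR₁
  have hcard : ((R₁.filter fun k => 1 ≤ pairTerm b p j₁ k).card : ℤ) =
      ∑ k ∈ R₁, (if 1 ≤ pairTerm b p j₁ k then (1 : ℤ) else 0) := by
    rw [sum_boole]
  rw [hcard, ← sum_sdiff hT, ← sum_sdiff hT (f := fun k => pairTerm b p j₁ k)]
  have h1 : ∑ k ∈ T, (if 1 ≤ pairTerm b p j₁ k then (1 : ℤ) else 0) = ∑ k ∈ T, (1 : ℤ) :=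
    sum_congr rfl fun k hk => by rw [if_pos (hT1 k hk)]
  have h2 : ∑ k ∈ R₁ \ T, (if 1 ≤ pairTerm b p j₁ k then (1 : ℤ) else 0) ≤ ∑ k ∈ R₁ \ T, pairTerm b p j₁ k := by
    refine sum_le_sum fun k hk => ?_
    have hk7 := mem_range.1 (mem_erase.1 (mem_sdiff.1 hk).1).2
    have := pairTerm_nonneg b hb p hj₁7 hk7
    split_ifs <;> linarith
  have h3 : ∑ k ∈ T, (pairTerm b p j₁ k - 1) = ∑ k ∈ T, pairTerm b p j₁ k - ∑ k ∈ T, (1 : ℤ) := by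
    rw [← sum_sub_distrib]
  rw [h1, h3]
  linarith

/-! ### Restricted pair sums -/

/-- `pairSum` is monotone in the index set (on the polytope). -/
theorem pairSum_mono (b : ℕ → ℤ) (hb : InPolytope b) (p : ℕ) {T S : Finset ℕ} (hTS : T ⊆ S) (hS : S ⊆ range 7) :
    pairSum b p T ≤ pairSum b p S := by
  unfold pairSum
  have hnn : ∀ i ∈ S, ∀ k ∈ S, (0 : ℤ) ≤ (if i < k then pairTerm b p i k else 0) := fun i hi k hk => by
    split_ifs
    · exact pairTerm_nonneg b hb p (mem_range.1 (hS hi)) (mem_range.1 (hS hk))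
    · exact le_rfl
  calc ∑ i ∈ T, ∑ k ∈ T, (if i < k then pairTerm b p i k else 0)
      ≤ ∑ i ∈ T, ∑ k ∈ S, (if i < k then pairTerm b p i k else 0) :=
        sum_le_sum fun i hi => sum_le_sum_of_subset_of_nonneg hTS fun k hk _ => hnn i (hTS hi) k hk
    _ ≤ ∑ i ∈ S, ∑ k ∈ S, (if i < k then pairTerm b p i k else 0) :=
        sum_le_sum_of_subset_of_nonneg hTS fun i hi _ => sum_nonneg fun k hk => hnn i hi k hk

/-- One pair with a unit floor gives `pairSum ≥ 1`. -/
theorem one_le_pairSum (b : ℕ → ℤ) (hb : InPolytope b) (p : ℕ) {S : Finset ℕ} (hS : S ⊆ range 7) {i k : ℕ}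
    (hi : i ∈ S) (hk : k ∈ S) (hik : i ≠ k) (h1 : 1 ≤ pairTerm b p i k) : 1 ≤ pairSum b p S := by
  rw [pairSum_erase b p hi]
  have hkmem : k ∈ S.erase i := mem_erase.2 ⟨hik.symm, hk⟩
  have hstar : 1 ≤ ∑ k' ∈ S.erase i, pairTerm b p i k' := by
    rw [← add_sum_erase _ _ hkmem]
    have : 0 ≤ ∑ k' ∈ (S.erase i).erase k, pairTerm b p i k' :=
      sum_nonneg fun k' hk' => pairTerm_nonneg b hb p (mem_range.1 (hS hi))
        (mem_range.1 (hS (mem_of_mem_erase (mem_of_mem_erase hk'))))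
    linarith
  have hrest := pairSum_nonneg b hb p (S := S.erase i) ((erase_subset _ _).trans hS)
  linarith

/-! ### Step 1: single-pole classes (`law_W ≤ 0` unless `H(3)`) -/

/-- **Step 1 of REPORT-gen2-g7 §1**: if `H(3)` fails then `law_W ≤ 0`. -/
theorem lawW_nonpos_of_not_goodClasses (b : ℕ → ℤ) {p : ℕ} (hb : InPolytope b) (hp5 : 5 ≤ p)
    (hng : ¬ GoodClasses b p 3) : lawW b p ≤ 0 := by
  by_contra hpos
  push Not at hpos
  have hbox : InBox b := hb.1
  have hp : 0 < p := by omega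
  have hle1 := lawWLeOne_holds b p hb hp5
  have hr : refundW b p ≤ 1 := min_le_left _ _
  have ha := topPartners_le_pairFloors b hb (show 1 ≤ p by omega)
  have haN : topPartners b p = pairFloors b p := by unfold lawW at hpos hle1; linarith
  apply hng
  intro y hy hcount
  -- the two largest blocks
  obtain ⟨j₁, hj₁, j₂, hj₂, hmin₁, hmin₂⟩ := exists_two_largest b
  have hj₁7 := mem_range.1 hj₁
  have hj₂7 := mem_range.1 (mem_erase.1 hj₂).2
  have hj₂1 : j₂ ≠ j₁ := (mem_erase.1 hj₂).1
  set R₁ := (range 7).erase j₁ with hR₁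
  -- `a = N` kills every pair floor off the star of `j₁`
  have hstar := topPartners_add_le_star b hb hp hj₁ hmin₁ (T := ∅) (empty_subset _) (by simp)
  rw [sum_empty, add_zero] at hstar
  have h1 := pairSum_erase b p (mem_range.2 hj₁7 : j₁ ∈ range 7)
  have h2 := pairSum_erase b p (mem_erase.2 ⟨hj₂1, mem_range.2 hj₂7⟩ : j₂ ∈ R₁)
  rw [pairSum_range, ← hR₁] at h1
  have hrest := pairSum_nonneg b hb p (S := R₁.erase j₂) ((erase_subset _ _).trans (erase_subset _ _))
  have hstar2nn : 0 ≤ ∑ k ∈ R₁.erase j₂, pairTerm b p j₂ k :=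
    sum_nonneg fun k hk => pairTerm_nonneg b hb p hj₂7 (mem_range.1 (mem_erase.1 (mem_erase.1 hk).2).2)
  have hstar2 : ∑ k ∈ R₁.erase j₂, pairTerm b p j₂ k = 0 := by linarith
  have hN2 : ∀ k ∈ R₁.erase j₂, pairTerm b p j₂ k = 0 := by
    refine (sum_eq_zero_iff_of_nonneg fun k hk => ?_).1 hstar2
    exact pairTerm_nonneg b hb p hj₂7 (mem_range.1 (mem_erase.1 (mem_erase.1 hk).2).2)
  -- the class `y`: two poles lie in `B_{j₂}`
  obtain ⟨q₁, hq₁, q₂, hq₂, hqne⟩ := one_lt_card.1 (by unfold classPoleCount at hcount; omega :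
    1 < ((classSet b p y).filter fun s => netExp b s < 0).card)
  rw [mem_filter] at hq₁ hq₂
  have hn2 : 2 ≤ nB b p y j₂ := by
    unfold nB
    refine one_lt_card.2 ⟨q₁, mem_filter.2 ⟨hq₁.1, ?_⟩, q₂, mem_filter.2 ⟨hq₂.1, ?_⟩, hqne⟩
    · exact mem_second_of_blockCount b hbox hj₂ hmin₂ (two_le_blockCount_of_pole b hq₁.2)
    · exact mem_second_of_blockCount b hbox hj₂ hmin₂ (two_le_blockCount_of_pole b hq₂.2)
  -- no third block is met
  have hzero : ∀ k ∈ R₁.erase j₂, nB b p y k = 0 := by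
    intro k hk
    by_contra hne
    have hk7 := mem_range.1 (mem_erase.1 (mem_erase.1 hk).2).2
    have hF1 := floorFact1 (x := y) b hb hp hj₂7 hk7 (by omega) (by omega)
    rw [hN2 k hk] at hF1
    have : (2 : ℤ) ≤ nB b p y j₂ := by exact_mod_cast hn2
    have : (1 : ℤ) ≤ nB b p y k := by exact_mod_cast Nat.one_le_iff_ne_zero.2 hne
    linarith
  -- `nB j₂ ≤ N_{j₁j₂} + 1 ≤ 2`
  have hF2 := floorFact2 (x := y) b hb hp hj₁7 hj₂7 (hmin₁ j₂ (mem_erase.1 hj₂).2) (by omega)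
  have hN12 : pairTerm b p j₁ j₂ ≤ 1 := by
    -- `a ≤ star − (N_{j₁j₂} − 1)` with `T = {j₂}` and `a = N ≥ star`
    by_contra hgt
    push Not at hgt
    have hT := topPartners_add_le_star b hb hp hj₁ hmin₁ (T := {j₂}) (singleton_subset_iff.2 hj₂)
      (fun k hk => by rw [mem_singleton.1 hk]; omega)
    rw [sum_singleton] at hT
    linarith
  -- assemble `E_y ≥ −2`
  have hE := classExp_ge_card_sub b p y
  rw [← add_sum_erase _ _ hj₁, ← add_sum_erase _ _ hj₂, sum_eq_zero (fun k hk => by rw [hzero k hk]; rfl)] at hE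
  have hC : (nB b p y j₁ : ℤ) ≤ (classSet b p y).card := by exact_mod_cast (card_filter_le _ _ : nB b p y j₁ ≤ _)
  push_cast at hE ⊢
  linarith

end Summit.KontsevichZagierPeriods.Zeta5Search.ClusterValuation

end
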